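import Mathlib
import Summits.ResolutionOfSingularities.ResolutionOfSingularities.Theorems.WeightedInvariantLocalWeightedDropPlaneBranchDropOfCount

/-!
# Helpers for the monomial phase of the plane tuple game — the potential of an exponent cloud

Crux `LocalWeightedDrop` (stmt-ResolutionOfSingularities-8899, route ResolutionOfSingularities/WeightedInvariant),
line `hasse-ridge-face-selection`, registered stub `stub_planeMonomialPhase` (file
`WeightedInvariantLocalWeightedDropPlaneMonomialPhase`).  Pure combinatorics of a non-empty family of lattice points
`(A_i, B_i) ∈ ℕ²` (the normalised exponents of the non-zero entries of a presented tuple): with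
`A_min = ⨅ A`, `B_min = ⨅ B`, the CORNERS `A@B_min = ⨅ {A_i : B_i = B_min}`, `B@A_min = ⨅ {B_i : A_i = A_min}`,
the SPREAD `(A@B_min - A_min) + (B@A_min - B_min)` and `S_min = ⨅ (A_i + B_i)`, the potential is
`ω · spread + S_min` (written out with `⨅`, no definitions).

* `shift_lt` — the CURVE MOVE `A ↦ A - t` (`0 < t ≤ A_i`): spread unchanged, `S_min` drops by `t`;
* `shear_lt` (registered sub-goal `stub_planeMonomialPhaseShear`) — the CORNER POINT MOVE `A ↦ A + B - t`
  (`t ≤ A_i + B_i`, some `B_i < t`): the new spread is `A@B_min - A_Q ≤ spread` (`Q` the point of the diagonal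
  `A + B = S_min` with least `B`), strictly unless the componentwise minimum `(A_min, B_min)` is attained, in which
  case both spreads vanish and `S_min' ≤ S_min + B_min - t < S_min`.

The infima are handled through `iInf_eq_of` / `riInf_eq_of` (value characterised by a lower bound that is attained).
-/

set_option linter.dupNamespace false -- mandated namespace of this single-conjunct summit

namespace Summit.ResolutionOfSingularities.ResolutionOfSingularities.Theorems

namespace PlaneMonomialPhase

variable {ι : Type}

/-! ### Infima of families of natural numbers -/

/-- `⨅ A ≤ A i`. -/
theorem iInf_le_apply (A : ι → ℕ) (i : ι) : iInf A ≤ A i := ciInf_le (OrderBot.bddBelow _) i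

/-- The infimum of a non-empty family of naturals is attained. -/
theorem exists_apply_eq_iInf [Nonempty ι] (A : ι → ℕ) : ∃ i, A i = iInf A := ciInf_mem A

/-- An attained lower bound is the infimum. -/
theorem iInf_eq_of (A : ι → ℕ) {m : ℕ} (h1 : ∀ i, m ≤ A i) (h2 : ∃ i, A i = m) : iInf A = m := by
  obtain ⟨i, hi⟩ := h2
  apply le_antisymm
  · rw [← hi]
    exact iInf_le_apply A i
  · haveI : Nonempty ι := ⟨i⟩
    obtain ⟨i', hi'⟩ := exists_apply_eq_iInf A
    rw [← hi']
    exact h1 i'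

/-- Restricted infimum: `⨅_{P} A ≤ A i` for `P i`. -/
theorem riInf_le (P : ι → Prop) (A : ι → ℕ) {i : ι} (hi : P i) : (⨅ l : {l // P l}, A l.1) ≤ A i :=
  iInf_le_apply (fun l : {l // P l} => A l.1) ⟨i, hi⟩

/-- A restricted infimum over a non-empty predicate is attained. -/
theorem exists_apply_eq_riInf (P : ι → Prop) (A : ι → ℕ) (h : ∃ i, P i) :
    ∃ i, P i ∧ A i = ⨅ l : {l // P l}, A l.1 := by
  obtain ⟨i, hi⟩ := h
  haveI : Nonempty {l // P l} := ⟨⟨i, hi⟩⟩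
  obtain ⟨⟨l, hl⟩, h⟩ := exists_apply_eq_iInf (fun l : {l // P l} => A l.1)
  exact ⟨l, hl, h⟩

/-- An attained lower bound is the restricted infimum. -/
theorem riInf_eq_of (P : ι → Prop) (A : ι → ℕ) {m : ℕ} (h1 : ∀ i, P i → m ≤ A i) (h2 : ∃ i, P i ∧ A i = m) :
    (⨅ l : {l // P l}, A l.1) = m := by
  obtain ⟨i, hi, him⟩ := h2
  exact iInf_eq_of (fun l : {l // P l} => A l.1) (fun l => h1 l.1 l.2) ⟨⟨i, hi⟩, him⟩

/-- Restricted infima over equivalent predicates agree. -/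
theorem riInf_congr {P Q : ι → Prop} (h : ∀ i, P i ↔ Q i) (A : ι → ℕ) :
    (⨅ l : {l // P l}, A l.1) = ⨅ l : {l // Q l}, A l.1 := by
  have hPQ : P = Q := funext fun i => propext (h i)
  subst hPQ
  rfl

/-! ### The two moves -/

/-- THE CURVE MOVE `A ↦ A - t` (`0 < t ≤ A_i` for all `i`): the spread is unchanged and `S_min` drops. -/
theorem shift_lt [Nonempty ι] (A B : ι → ℕ) {t : ℕ} (ht : 0 < t) (hA : ∀ i, t ≤ A i) :
    Ordinal.omega0 * (((⨅ i : {i // B i = iInf B}, (A i.1 - t)) - iInf (fun i => A i - t) +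
        ((⨅ i : {i // A i - t = iInf (fun l => A l - t)}, B i.1) - iInf B) : ℕ) : Ordinal.{0}) +
      ((⨅ i, (A i - t + B i) : ℕ) : Ordinal.{0}) <
    Ordinal.omega0 * (((⨅ i : {i // B i = iInf B}, A i.1) - iInf A +
        ((⨅ i : {i // A i = iInf A}, B i.1) - iInf B) : ℕ) : Ordinal.{0}) +
      ((⨅ i, (A i + B i) : ℕ) : Ordinal.{0}) := by
  have hAle := iInf_le_apply A
  obtain ⟨ia, hia⟩ := exists_apply_eq_iInf A
  obtain ⟨ib, hib⟩ := exists_apply_eq_iInf B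
  have hSle : ∀ i, (⨅ l, (A l + B l)) ≤ A i + B i := iInf_le_apply (fun l => A l + B l)
  obtain ⟨is, his⟩ : ∃ i, A i + B i = ⨅ l, (A l + B l) := exists_apply_eq_iInf (fun l => A l + B l)
  obtain ⟨ja, hjaP, hja⟩ := exists_apply_eq_riInf (fun i => B i = iInf B) A ⟨ib, hib⟩
  -- the shifted minima
  have h1 : iInf (fun i => A i - t) = iInf A - t :=
    iInf_eq_of _ (fun i => Nat.sub_le_sub_right (hAle i) t) ⟨ia, by rw [hia]⟩
  have h2 : (⨅ i : {i // B i = iInf B}, (A i.1 - t)) = (⨅ i : {i // B i = iInf B}, A i.1) - t :=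
    riInf_eq_of (fun i => B i = iInf B) (fun i => A i - t)
      (fun i hi => Nat.sub_le_sub_right (riInf_le (fun i => B i = iInf B) A hi) t) ⟨ja, hjaP, by rw [hja]⟩
  have h3 : (⨅ i : {i // A i - t = iInf (fun l => A l - t)}, B i.1) = ⨅ i : {i // A i = iInf A}, B i.1 := by
    refine riInf_congr (fun i => ?_) B
    rw [h1]
    have := hAle i
    have := hA i
    have := hA ia
    omega
  have h4 : (⨅ i, (A i - t + B i)) = (⨅ l, (A l + B l)) - t :=
    iInf_eq_of _ (fun i => by have := hSle i; have := hA i; omega) ⟨is, by have := hA is; omega⟩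
  rw [h3, h2, h1, h4]
  have ht1 : t ≤ iInf A := hia ▸ hA ia
  have ht2 : iInf A ≤ ⨅ i : {i // B i = iInf B}, A i.1 := hja ▸ hAle ja
  have ht3 : t ≤ ⨅ l, (A l + B l) := by rw [← his]; exact (hA is).trans (Nat.le_add_right _ _)
  have hsp : (⨅ i : {i // B i = iInf B}, A i.1) - t - (iInf A - t) =
      (⨅ i : {i // B i = iInf B}, A i.1) - iInf A := by omega
  rw [hsp]
  exact (add_lt_add_iff_left _).mpr (by exact_mod_cast (by omega : (⨅ l, (A l + B l)) - t < ⨅ l, (A l + B l)))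

/-- THE CORNER POINT MOVE `A ↦ A + B - t` (`t ≤ A_i + B_i` for all `i`, `B_i < t` for some `i`): the potential
`ω · spread + S_min` drops strictly. -/
theorem shear_lt [Nonempty ι] (A B : ι → ℕ) {t : ℕ} (hS : ∀ i, t ≤ A i + B i) (hB : ∃ i, B i < t) :
    Ordinal.omega0 * (((⨅ i : {i // B i = iInf B}, (A i.1 + B i.1 - t)) - iInf (fun i => A i + B i - t) +
        ((⨅ i : {i // A i + B i - t = iInf (fun l => A l + B l - t)}, B i.1) - iInf B) : ℕ) : Ordinal.{0}) +
      ((⨅ i, (A i + B i - t + B i) : ℕ) : Ordinal.{0}) <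
    Ordinal.omega0 * (((⨅ i : {i // B i = iInf B}, A i.1) - iInf A +
        ((⨅ i : {i // A i = iInf A}, B i.1) - iInf B) : ℕ) : Ordinal.{0}) +
      ((⨅ i, (A i + B i) : ℕ) : Ordinal.{0}) := by
  have hAle := iInf_le_apply A
  obtain ⟨ia, hia⟩ := exists_apply_eq_iInf A
  have hBle := iInf_le_apply B
  obtain ⟨ib, hib⟩ := exists_apply_eq_iInf B
  have hSle : ∀ i, (⨅ l, (A l + B l)) ≤ A i + B i := iInf_le_apply (fun l => A l + B l)
  obtain ⟨is, his⟩ : ∃ i, A i + B i = ⨅ l, (A l + B l) := exists_apply_eq_iInf (fun l => A l + B l)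
  -- the corners of `(A, B)` and the corner `Q` of the diagonal
  obtain ⟨ja, hjaP, hja⟩ := exists_apply_eq_riInf (fun i => B i = iInf B) A ⟨ib, hib⟩
  obtain ⟨jb, hjbP, hjb⟩ := exists_apply_eq_riInf (fun i => A i = iInf A) B ⟨ia, hia⟩
  obtain ⟨q, hqP, hq⟩ := exists_apply_eq_riInf (fun i => A i + B i = ⨅ l, (A l + B l)) B ⟨is, his⟩
  -- the sheared minima
  have h1 : iInf (fun i => A i + B i - t) = (⨅ l, (A l + B l)) - t :=
    iInf_eq_of _ (fun i => Nat.sub_le_sub_right (hSle i) t) ⟨is, by rw [his]⟩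
  have h2 : (⨅ i : {i // B i = iInf B}, (A i.1 + B i.1 - t)) =
      (⨅ i : {i // B i = iInf B}, A i.1) + iInf B - t :=
    riInf_eq_of (fun i => B i = iInf B) (fun i => A i + B i - t)
      (fun i hi => by have := riInf_le (fun i => B i = iInf B) A hi; omega) ⟨ja, hjaP, by rw [hja, hjaP]⟩
  have h3 : (⨅ i : {i // A i + B i - t = iInf (fun l => A l + B l - t)}, B i.1) =
      ⨅ i : {i // A i + B i = ⨅ l, (A l + B l)}, B i.1 := by
    refine riInf_congr (fun i => ?_) B
    rw [h1]
    have := hSle i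
    have := hS i
    have := hS is
    omega
  rw [h3, h2, h1]
  -- bookkeeping inequalities between the named minima
  have k1 : t ≤ ⨅ l, (A l + B l) := his ▸ hS is
  have k2 : (⨅ l, (A l + B l)) ≤ (⨅ i : {i // B i = iInf B}, A i.1) + iInf B := hja ▸ hjaP ▸ hSle ja
  have k3 : iInf B ≤ ⨅ i : {i // A i + B i = ⨅ l, (A l + B l)}, B i.1 := hq ▸ hBle q
  have k4 : iInf A + (⨅ i : {i // A i + B i = ⨅ l, (A l + B l)}, B i.1) ≤ ⨅ l, (A l + B l) := by
    rw [← hq, ← hqP]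
    exact Nat.add_le_add_right (hAle q) _
  have k5 : iInf B ≤ ⨅ i : {i // A i = iInf A}, B i.1 := hjb ▸ hBle jb
  have k6 : iInf A ≤ ⨅ i : {i // B i = iInf B}, A i.1 := hja ▸ hAle ja
  by_cases hcase : iInf A + (⨅ i : {i // A i + B i = ⨅ l, (A l + B l)}, B i.1) < ⨅ l, (A l + B l) ∨
      iInf B < ⨅ i : {i // A i = iInf A}, B i.1
  · -- the spread drops
    exact PlaneBranchDropOfCount.omega_mul_add_lt _ _ (by omega)
  · -- the componentwise minimum `(A_min, B_min)` is attained at `jb`: spreads vanish, `S_min` drops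
    push Not at hcase
    obtain ⟨hc1, hc2⟩ := hcase
    have hjbB : B jb = iInf B := by rw [hjb]; omega
    have k7 : (⨅ i : {i // B i = iInf B}, A i.1) ≤ iInf A := hjbP ▸ riInf_le (fun i => B i = iInf B) A hjbB
    have k8 : (⨅ l, (A l + B l)) ≤ iInf A + iInf B := hjbP ▸ hjbB ▸ hSle jb
    have hsp : (⨅ i : {i // B i = iInf B}, A i.1) + iInf B - t - ((⨅ l, (A l + B l)) - t) +
        ((⨅ i : {i // A i + B i = ⨅ l, (A l + B l)}, B i.1) - iInf B) =
        (⨅ i : {i // B i = iInf B}, A i.1) - iInf A + ((⨅ i : {i // A i = iInf A}, B i.1) - iInf B) := by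
      omega
    rw [hsp]
    refine (add_lt_add_iff_left _).mpr ?_
    obtain ⟨i₀, hi₀⟩ := hB
    have k9 := hBle i₀
    have k10 : (⨅ i, (A i + B i - t + B i)) ≤ A jb + B jb - t + B jb := iInf_le_apply (fun i => A i + B i - t + B i) jb
    rw [hjbP, hjbB] at k10
    exact_mod_cast (by omega : (⨅ i, (A i + B i - t + B i)) < ⨅ l, (A l + B l))

end PlaneMonomialPhase

/-- Registered sub-goal `stub_planeMonomialPhaseShear` of `stub_planeMonomialPhase`: THE CORNER POINT MOVE LOWERS THE
POTENTIAL OF AN EXPONENT CLOUD.  For a non-empty family of lattice points `(A_i, B_i)` and `t` with `t ≤ A_i + B_i`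
for all `i` and `B_i < t` for some `i`, the shear `(A, B) ↦ (A + B - t, B)` strictly lowers
`ω · spread + S_min`, where `S_min = ⨅ (A_i + B_i)` and
`spread = (⨅{A_i : B_i = B_min} - A_min) + (⨅{B_i : A_i = A_min} - B_min)`. -/
theorem stub_planeMonomialPhaseShear : ∀ (ι : Type) [Nonempty ι] (A B : ι → ℕ) (t : ℕ),
    (∀ i, t ≤ A i + B i) → (∃ i, B i < t) →
    Ordinal.omega0 * (((⨅ i : {i // B i = iInf B}, (A i.1 + B i.1 - t)) - iInf (fun i => A i + B i - t) +
        ((⨅ i : {i // A i + B i - t = iInf (fun l => A l + B l - t)}, B i.1) - iInf B) : ℕ) : Ordinal.{0}) +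
      ((⨅ i, (A i + B i - t + B i) : ℕ) : Ordinal.{0}) <
    Ordinal.omega0 * (((⨅ i : {i // B i = iInf B}, A i.1) - iInf A +
        ((⨅ i : {i // A i = iInf A}, B i.1) - iInf B) : ℕ) : Ordinal.{0}) +
      ((⨅ i, (A i + B i) : ℕ) : Ordinal.{0}) := by
  intro ι _ A B t hS hB
  exact PlaneMonomialPhase.shear_lt A B hS hB

end Summit.ResolutionOfSingularities.ResolutionOfSingularities.Theorems
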